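import Summits.NavierStokesRegularity.NavierStokesRegularity.Theorems.FilamentSkeletonRssCoreLinearInvertibilityGradientInClassTools
import Summits.NavierStokesRegularity.NavierStokesRegularity.Theorems.FilamentSkeletonRssCoreLinearInvertibilityGradientInClassIBP

/-!
# Stub `stub_gradientInClass` of crux `CoreLinearInvertibility` (stmt-NavierStokesRegularity-17973),
# line `Sketch`

For `w` in the crux class (`C²`, `w` and `T_{λ,R}w` in `X_λ = L²(G_λ⁻¹dx)`, pointwise convergent
Biot–Savart integrals) the gradient lies in `X_λ`: `∫ G_λ⁻¹‖∇w‖² < ∞`.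

Proof (truncated energy identity; log: v1 — direct, no dead ends): with `g = G_λ⁻¹`
(`∇g = ((1−λ)/2) x g`), the cut-off `χ = χ_S` (`S = k+1 ≥ 1`, `‖Dχ‖ ≤ C`, `‖Dχ(x)‖|x| ≤ 2C`) and
`ρ = χ²g ∈ C¹_c`, test `T w = L_λ w − R(⟪v^G,∇w⟫ + ⟪K∗w,∇G⟫)` against `ρ w`: one integration by
parts for `∫ ρ w Δw` and one for the combined drift `λ x₀ ∂₀` (the `(1−λ)/2`-parts of `b_λ·∇w`
cancel against `w⟪∇w, ∇g⟫χ²`), giving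
`∫ρ‖∇w‖² = −∫ρ Tw·w − ½∫∂₀(λx₀ρ) w² + ∫ρw² − R∫ρ⟪v^G,∇w⟫w − R∫ρ⟪K∗w,∇G⟫w − 2∫χ g w⟪∇χ,∇w⟫`;
every term on the right is bounded, uniformly in `k`, by `∫g(Tw)²`, `∫g w²`, the Schur integral
`∫ g|⟪K∗w,∇G⟫||w|` (tools file) and `¼∫ρ‖∇w‖²` (absorbed; `v^G` is bounded, and the `x₀²`-weight
of `∂₀(λx₀ρ)` has the good sign `λ(1−λ)/4 ≥ 0`). Fatou along `χ_{k+1} → 1` concludes.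
-/

set_option linter.dupNamespace false

noncomputable section

namespace Summit.NavierStokesRegularity.NavierStokesRegularity.Theorems

open MeasureTheory Filter Topology Set Metric
open Literature.Analysis.FluidPDE
open scoped InnerProductSpace Laplacian ContDiff
open Summit.AnomalousDissipation.AnomalousDissipation.Theorems.MarginalStabilityChainStretchedVortexRows
  (continuous_strainedVorticityOperator)

/-- **The truncated energy estimate.** For `w` in the crux class, a cut-off `χ_S` (`S ≥ 1`) with
`‖Dχ_S‖ ≤ C`, `‖Dχ_S(x)‖‖x‖ ≤ 2C`, and `g = G_λ⁻¹`:
`∫ χ_S² g‖∇w‖² ≤ ∫ g(Tw)² + (3 + 32C² + 4C + 2R²(4π)⁻²)∫ g w² + 2|R| ∫ g|⟪K∗w,∇G⟫||w|`.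
[folklore] -/
theorem integral_cutoff_sq_mul_inv_gaussWeightLam_mul_norm_gradient_sq_le {lam : ℝ}
    (hlam : lam ∈ Set.Ico (0 : ℝ) 1) (R : ℝ) {w : EuclideanSpace ℝ (Fin 2) → ℝ}
    (hw : ContDiff ℝ 2 w) (hX : Integrable fun x => (gaussWeightLam lam x)⁻¹ * w x ^ 2)
    (hT : Integrable fun x => (gaussWeightLam lam x)⁻¹ * (strainedVorticityOperator lam w x -
      R * (⟪gaussVortexVelocity x, gradient w x⟫_ℝ +
        ⟪biotSavart2D w x, gradient gaussVortexProfile x⟫_ℝ)) ^ 2)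
    (hN : Integrable fun x => (gaussWeightLam lam x)⁻¹ *
      (|⟪biotSavart2D w x, gradient gaussVortexProfile x⟫_ℝ| * |w x|))
    {C S : ℝ} (hC0 : 0 ≤ C) (hS : 1 ≤ S)
    (hC : ∀ x : EuclideanSpace ℝ (Fin 2),
      ‖fderiv ℝ (cutoff S) x‖ ≤ C ∧ ‖fderiv ℝ (cutoff S) x‖ * ‖x‖ ≤ 2 * C) :
    ∫ x, cutoff S x ^ 2 * ((gaussWeightLam lam x)⁻¹ * ‖gradient w x‖ ^ 2) ≤
      (∫ x, (gaussWeightLam lam x)⁻¹ * (strainedVorticityOperator lam w x -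
        R * (⟪gaussVortexVelocity x, gradient w x⟫_ℝ +
          ⟪biotSavart2D w x, gradient gaussVortexProfile x⟫_ℝ)) ^ 2) +
      (3 + 32 * C ^ 2 + 4 * C + 2 * (R * (4 * Real.pi)⁻¹) ^ 2) *
        (∫ x, (gaussWeightLam lam x)⁻¹ * w x ^ 2) +
      2 * |R| * ∫ x, (gaussWeightLam lam x)⁻¹ *
        (|⟪biotSavart2D w x, gradient gaussVortexProfile x⟫_ℝ| * |w x|) := by
  obtain ⟨hl0, hl1⟩ := hlam
  have hS0 : 0 < S := by linarith
  -- the three integrals on the right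
  set IT : ℝ := ∫ x, (gaussWeightLam lam x)⁻¹ * (strainedVorticityOperator lam w x -
      R * (⟪gaussVortexVelocity x, gradient w x⟫_ℝ +
        ⟪biotSavart2D w x, gradient gaussVortexProfile x⟫_ℝ)) ^ 2 with hIT
  set IX : ℝ := ∫ x, (gaussWeightLam lam x)⁻¹ * w x ^ 2 with hIX
  set IN : ℝ := ∫ x, (gaussWeightLam lam x)⁻¹ *
      (|⟪biotSavart2D w x, gradient gaussVortexProfile x⟫_ℝ| * |w x|) with hIN
  -- abbreviations
  set g : EuclideanSpace ℝ (Fin 2) → ℝ := fun x => (gaussWeightLam lam x)⁻¹ with hg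
  set V : EuclideanSpace ℝ (Fin 2) → ℝ := fun x => ⟪gaussVortexVelocity x, gradient w x⟫_ℝ
    with hV
  set N : EuclideanSpace ℝ (Fin 2) → ℝ := fun x =>
    ⟪biotSavart2D w x, gradient gaussVortexProfile x⟫_ℝ with hNdef
  set T : EuclideanSpace ℝ (Fin 2) → ℝ := fun x =>
    strainedVorticityOperator lam w x - R * (V x + N x) with hTdef
  set χ : EuclideanSpace ℝ (Fin 2) → ℝ := cutoff S with hχ
  set ρ : EuclideanSpace ℝ (Fin 2) → ℝ := fun x => χ x ^ 2 * g x with hρ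
  -- coordinate partial derivatives of `w` and `χ`
  set w₀ : EuclideanSpace ℝ (Fin 2) → ℝ := fun x => fderiv ℝ w x (EuclideanSpace.single 0 1)
    with hw₀
  set w₁ : EuclideanSpace ℝ (Fin 2) → ℝ := fun x => fderiv ℝ w x (EuclideanSpace.single 1 1)
    with hw₁
  set χ₀ : EuclideanSpace ℝ (Fin 2) → ℝ := fun x => fderiv ℝ χ x (EuclideanSpace.single 0 1)
    with hχ₀
  set χ₁ : EuclideanSpace ℝ (Fin 2) → ℝ := fun x => fderiv ℝ χ x (EuclideanSpace.single 1 1)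
    with hχ₁
  have hT' : Integrable fun x => g x * T x ^ 2 := hT
  have hX' : Integrable fun x => g x * w x ^ 2 := hX
  have hN' : Integrable fun x => g x * (|N x| * |w x|) := hN
  have hIT' : ∫ x, g x * T x ^ 2 = IT := rfl
  have hIX' : ∫ x, g x * w x ^ 2 = IX := rfl
  have hIN' : ∫ x, g x * (|N x| * |w x|) = IN := rfl
  -- basic facts
  have hgpos : ∀ x, 0 < g x := fun x => inv_pos.2 (gaussWeightLam_pos hl1 x)
  have hg1 : ContDiff ℝ 1 g := contDiff_inv_gaussWeightLam lam
  have hgc : Continuous g := hg1.continuous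
  have hgd : ∀ x v, fderiv ℝ g x v = (1 - lam) / 2 * ⟪x, v⟫_ℝ * g x :=
    fderiv_inv_gaussWeightLam_apply lam
  have hwc : Continuous w := hw.continuous
  have hw1 : ContDiff ℝ 1 w := hw.of_le one_le_two
  have hdc : ∀ v : EuclideanSpace ℝ (Fin 2), Continuous fun x => fderiv ℝ w x v := fun v =>
    (hw.continuous_fderiv two_ne_zero).clm_apply continuous_const
  have hw₀c : Continuous w₀ := hdc _
  have hw₁c : Continuous w₁ := hdc _
  have hgradc : Continuous (gradient w) := continuous_gradient_of_contDiff hw1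
  have hVc : Continuous V := continuous_inner_gaussVortexVelocity_gradient hw1
  have hNm : AEStronglyMeasurable N volume :=
    (stronglyMeasurable_biotSavart2D hwc.measurable).aestronglyMeasurable.inner
      (continuous_gradient_of_contDiff
        (contDiff_gaussVortexProfile (n := 1))).aestronglyMeasurable
  have hTm : AEStronglyMeasurable T volume :=
    (continuous_strainedVorticityOperator hw lam).aestronglyMeasurable.sub
      ((hVc.aestronglyMeasurable.add hNm).const_mul R)
  -- the cut-off
  have hχs : ContDiff ℝ 1 χ := contDiff_cutoff (n := 1) S
  have hχc' : Continuous χ := hχs.continuous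
  have hχcs : HasCompactSupport χ := hasCompactSupport_cutoff hS0
  have hχ0 : ∀ x, 0 ≤ χ x := cutoff_nonneg S
  have hχ1 : ∀ x, χ x ≤ 1 := cutoff_le_one S
  have hDχx : ∀ x, ‖fderiv ℝ χ x‖ * ‖x‖ ≤ 2 * C := fun x => (hC x).2
  have hχd : ∀ (x : EuclideanSpace ℝ (Fin 2)) (i : Fin 2),
      |fderiv ℝ χ x (EuclideanSpace.single i 1)| ≤ ‖fderiv ℝ χ x‖ := by
    intro x i
    rw [← Real.norm_eq_abs]
    calc ‖fderiv ℝ χ x (EuclideanSpace.single i 1)‖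
        ≤ ‖fderiv ℝ χ x‖ * ‖EuclideanSpace.single i (1 : ℝ)‖ := ContinuousLinearMap.le_opNorm _ _
      _ = ‖fderiv ℝ χ x‖ := by simp
  have hχ₀C : ∀ x, |χ₀ x| ≤ C := fun x => (hχd x 0).trans (hC x).1
  have hχ₁C : ∀ x, |χ₁ x| ≤ C := fun x => (hχd x 1).trans (hC x).1
  have hdχc : ∀ v : EuclideanSpace ℝ (Fin 2), Continuous fun x => fderiv ℝ χ x v := fun v =>
    (hχs.continuous_fderiv one_ne_zero).clm_apply continuous_const
  have hχ₀c : Continuous χ₀ := hdχc _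
  have hχ₁c : Continuous χ₁ := hdχc _
  -- the weight `ρ = χ² g`
  have hρs : ContDiff ℝ 1 ρ := (hχs.pow 2).mul hg1
  have hρc' : Continuous ρ := hρs.continuous
  have hρcs : HasCompactSupport ρ := by
    refine hχcs.mono fun x hx => ?_
    contrapose! hx
    simp only [Function.mem_support, ne_eq, not_not] at hx ⊢
    simp [hρ, hx]
  have hρ0 : ∀ x, 0 ≤ ρ x := fun x => mul_nonneg (sq_nonneg _) (hgpos x).le
  have hρg : ∀ x, ρ x ≤ g x := fun x => by
    have h0 := hχ0 x; have h1 := hχ1 x; have hgx := hgpos x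
    have hsq : χ x ^ 2 ≤ 1 := by nlinarith
    calc ρ x = χ x ^ 2 * g x := rfl
      _ ≤ 1 * g x := by gcongr
      _ = g x := one_mul _
  have hρd : ∀ x v, fderiv ℝ ρ x v =
      2 * χ x * fderiv ℝ χ x v * g x + χ x ^ 2 * ((1 - lam) / 2 * ⟪x, v⟫_ℝ * g x) := by
    intro x v
    have hχx : DifferentiableAt ℝ χ x := hχs.differentiable one_ne_zero x
    have hgx : DifferentiableAt ℝ g x := hg1.differentiable one_ne_zero x
    rw [show ρ = fun y => χ y ^ 2 * g y from rfl,
      ((hχx.hasFDerivAt.pow 2).fun_mul hgx.hasFDerivAt).fderiv]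
    simp [hgd]
    ring
  have hρ₀ : ∀ x, fderiv ℝ ρ x (EuclideanSpace.single 0 1) =
      2 * χ x * χ₀ x * g x + χ x ^ 2 * ((1 - lam) / 2 * x 0 * g x) := fun x => by
    rw [hρd, inner_single_one_right]
  have hρ₁ : ∀ x, fderiv ℝ ρ x (EuclideanSpace.single 1 1) =
      2 * χ x * χ₁ x * g x + χ x ^ 2 * ((1 - lam) / 2 * x 1 * g x) := fun x => by
    rw [hρd, inner_single_one_right]
  -- integrability against `ρ` and `χ`
  have hIρ : ∀ {f : EuclideanSpace ℝ (Fin 2) → ℝ}, Continuous f →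
      Integrable (fun x => ρ x * f x) := fun hf =>
    (hρc'.mul hf).integrable_of_hasCompactSupport hρcs.mul_right
  have hIχ : ∀ {f : EuclideanSpace ℝ (Fin 2) → ℝ}, Continuous f →
      Integrable (fun x => χ x * f x) := fun hf =>
    (hχc'.mul hf).integrable_of_hasCompactSupport hχcs.mul_right
  have hx0c : Continuous fun x : EuclideanSpace ℝ (Fin 2) => x 0 := PiLp.continuous_apply 2 _ 0
  have hx1c : Continuous fun x : EuclideanSpace ℝ (Fin 2) => x 1 := PiLp.continuous_apply 2 _ 1
  -- the drift coefficient `c = λ x₀ ρ`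
  set c : EuclideanSpace ℝ (Fin 2) → ℝ := fun x => lam * x 0 * ρ x with hcdef
  have hproj : ContDiff ℝ 1 fun y : EuclideanSpace ℝ (Fin 2) => y 0 :=
    (EuclideanSpace.proj (0 : Fin 2) : EuclideanSpace ℝ (Fin 2) →L[ℝ] ℝ).contDiff
  have hcs : ContDiff ℝ 1 c := (contDiff_const.mul hproj).mul hρs
  have hcc : HasCompactSupport c := hρcs.mul_left
  have hcd : ∀ x, fderiv ℝ c x (EuclideanSpace.single 0 1) =
      lam * (ρ x + x 0 * fderiv ℝ ρ x (EuclideanSpace.single 0 1)) := by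
    intro x
    have h0 : HasFDerivAt (fun y : EuclideanSpace ℝ (Fin 2) => lam * y 0)
        (lam • (EuclideanSpace.proj (0 : Fin 2) : EuclideanSpace ℝ (Fin 2) →L[ℝ] ℝ)) x :=
      ((EuclideanSpace.proj (0 : Fin 2) :
        EuclideanSpace ℝ (Fin 2) →L[ℝ] ℝ).hasFDerivAt).const_mul lam
    have hρx : DifferentiableAt ℝ ρ x := hρs.differentiable one_ne_zero x
    rw [show c = fun y => lam * y 0 * ρ y from rfl, (h0.fun_mul hρx.hasFDerivAt).fderiv]
    simp
    ring
  -- the two integrations by parts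
  have eL := integral_mul_mul_laplacian_eq hw hρs hρcs
  have eD := integral_mul_mul_fderiv_apply_eq hw1 hcs hcc (EuclideanSpace.single 0 1)
  -- the integrands
  set fF : EuclideanSpace ℝ (Fin 2) → ℝ := fun x => ρ x * ‖gradient w x‖ ^ 2 with hfF
  set fA : EuclideanSpace ℝ (Fin 2) → ℝ := fun x => ρ x * (w x * Δ w x) with hfA
  set fD : EuclideanSpace ℝ (Fin 2) → ℝ := fun x =>
    ρ x * (w x * ((1 + lam) / 2 * x 0 * w₀ x + (1 - lam) / 2 * x 1 * w₁ x)) with hfD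
  set fQ : EuclideanSpace ℝ (Fin 2) → ℝ := fun x => ρ x * (w x * w x) with hfQ
  set fV : EuclideanSpace ℝ (Fin 2) → ℝ := fun x => ρ x * (R * V x * w x) with hfV
  set fT : EuclideanSpace ℝ (Fin 2) → ℝ := fun x => ρ x * (T x * w x) with hfT
  set fP : EuclideanSpace ℝ (Fin 2) → ℝ := fun x => ρ x * (R * N x * w x) with hfP
  set fX : EuclideanSpace ℝ (Fin 2) → ℝ := fun x =>
    χ x * (2 * g x * w x * (χ₀ x * w₀ x + χ₁ x * w₁ x)) with hfX
  set fI : EuclideanSpace ℝ (Fin 2) → ℝ := fun x =>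
    ρ x * ((1 - lam) / 2 * w x * (x 0 * w₀ x + x 1 * w₁ x)) with hfI
  set fB : EuclideanSpace ℝ (Fin 2) → ℝ := fun x => ρ x * (w₀ x ^ 2 + w₁ x ^ 2) +
    w x * (fderiv ℝ ρ x (EuclideanSpace.single 0 1) * w₀ x +
      fderiv ℝ ρ x (EuclideanSpace.single 1 1) * w₁ x) with hfB
  set fI2 : EuclideanSpace ℝ (Fin 2) → ℝ := fun x => c x * (w x * w₀ x) with hfI2
  set fJ : EuclideanSpace ℝ (Fin 2) → ℝ := fun x =>
    fderiv ℝ c x (EuclideanSpace.single 0 1) * w x ^ 2 with hfJ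
  have eL' : ∫ x, fA x = -∫ x, fB x := eL
  have eD' : ∫ x, fI2 x = -(1 / 2) * ∫ x, fJ x := eD
  have iF : Integrable fF := hIρ (hgradc.norm.pow 2)
  have iA : Integrable fA := hIρ (hwc.mul (continuous_laplacian hw))
  have iD : Integrable fD :=
    hIρ (hwc.mul ((((continuous_const.mul hx0c).mul hw₀c)).add
      ((continuous_const.mul hx1c).mul hw₁c)))
  have iQ : Integrable fQ := hIρ (hwc.mul hwc)
  have iV : Integrable fV := hIρ ((continuous_const.mul hVc).mul hwc)
  have iX : Integrable fX :=
    hIχ (((continuous_const.mul hgc).mul hwc).mul ((hχ₀c.mul hw₀c).add (hχ₁c.mul hw₁c)))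
  have iI : Integrable fI :=
    hIρ ((continuous_const.mul hwc).mul ((hx0c.mul hw₀c).add (hx1c.mul hw₁c)))
  have iI2 : Integrable fI2 :=
    (hcs.continuous.mul (hwc.mul hw₀c)).integrable_of_hasCompactSupport hcc.mul_right
  have iJ : Integrable fJ :=
    (((hcs.continuous_fderiv one_ne_zero).clm_apply continuous_const).mul (hwc.pow 2))
      |>.integrable_of_hasCompactSupport (hcc.fderiv_apply (𝕜 := ℝ) _).mul_right
  -- `ρ T w` is integrable by domination `|ρ T w| ≤ g(T² + w²)/2`
  have iT : Integrable fT := by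
    refine Integrable.mono' ((hT'.add hX').div_const 2)
      (hρc'.aestronglyMeasurable.mul (hTm.mul hwc.aestronglyMeasurable))
      (Eventually.of_forall fun x => ?_)
    rw [Real.norm_eq_abs]
    exact abs_weight_mul_mul_le (hρ0 x) (hρg x)
  -- (p1) the operator identity: the nonlocal pairing is integrable as a combination
  have p1 : ∀ x, fP x = fA x + fD x + fQ x - fV x - fT x := by
    intro x
    simp only [hfP, hfA, hfD, hfQ, hfV, hfT, hTdef, hw₀, hw₁, strainedVorticityOperator]
    ring
  have i2 : Integrable fun x => fA x + fD x := iA.add iD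
  have i3 : Integrable fun x => fA x + fD x + fQ x := i2.add iQ
  have i4 : Integrable fun x => fA x + fD x + fQ x - fV x := i3.sub iV
  have iP : Integrable fP := (i4.sub iT).congr (Eventually.of_forall fun x => (p1 x).symm)
  have eP : ∫ x, fP x =
      (∫ x, fA x) + (∫ x, fD x) + (∫ x, fQ x) - (∫ x, fV x) - ∫ x, fT x := by
    rw [integral_congr_ae (Eventually.of_forall p1), integral_sub i4 iT, integral_sub i3 iV,
      integral_add i2 iQ, integral_add iA iD]
  -- (p2) the Laplacian pairing splits as `∫ρ‖∇w‖² + ∫ commutator + ∫ I₃`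
  have p2 : ∀ x, fB x = fF x + fX x + fI x := by
    intro x
    simp only [hfB, hfF, hfX, hfI]
    rw [norm_gradient_sq_eq_fin_two, hρ₀, hρ₁]
    simp only [hρ, hw₀, hw₁]
    ring
  have i5 : Integrable fun x => fF x + fX x := iF.add iX
  have eB : ∫ x, fB x = (∫ x, fF x) + (∫ x, fX x) + ∫ x, fI x := by
    rw [integral_congr_ae (Eventually.of_forall p2), integral_add i5 iI, integral_add iF iX]
  -- (p3) the drift: `ρ w b·∇w = c w ∂₀w + I₃`
  have p3 : ∀ x, fD x = fI2 x + fI x := by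
    intro x; simp only [hfD, hfI2, hfI, hcdef]; ring
  have eDs : ∫ x, fD x = (∫ x, fI2 x) + ∫ x, fI x := by
    rw [integral_congr_ae (Eventually.of_forall p3), integral_add iI2 iI]
  -- (N6) the drift pairing has the good sign up to `4C ∫ g w²`
  have nJ : -(4 * C) * IX ≤ ∫ x, fJ x := by
    rw [← hIX', ← integral_const_mul]
    refine integral_mono (hX'.const_mul _) iJ fun x => ?_
    have hx0 : |x 0| ≤ ‖x‖ := by
      have h := PiLp.norm_apply_le (p := 2) x 0
      rwa [Real.norm_eq_abs] at h
    have hprod : |x 0| * |χ₀ x| ≤ 2 * C :=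
      (mul_le_mul hx0 (hχd x 0) (abs_nonneg _) (norm_nonneg _)).trans
        (by rw [mul_comm]; exact hDχx x)
    have hlow := neg_le_drift_coeff hl0 hl1.le (hχ0 x) (hχ1 x) (hgpos x).le hprod
    have hexp : fderiv ℝ c x (EuclideanSpace.single 0 1) = lam * χ x ^ 2 * g x +
        2 * lam * χ x * g x * (x 0 * χ₀ x) + lam * (1 - lam) / 2 * x 0 ^ 2 * χ x ^ 2 * g x := by
      rw [hcd, hρ₀]; simp only [hρ]; ring
    show -(4 * C) * (g x * w x ^ 2) ≤ fderiv ℝ c x (EuclideanSpace.single 0 1) * w x ^ 2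
    calc -(4 * C) * (g x * w x ^ 2) = -(4 * C * g x) * w x ^ 2 := by ring
      _ ≤ fderiv ℝ c x (EuclideanSpace.single 0 1) * w x ^ 2 :=
          mul_le_mul_of_nonneg_right (by rw [hexp]; exact hlow) (sq_nonneg _)
  -- (N1) the `T`-pairing
  have nT : -(∫ x, fT x) ≤ (IT + IX) / 2 := by
    rw [← integral_neg, ← hIT', ← hIX', ← integral_add hT' hX', ← integral_div]
    refine integral_mono iT.neg ((hT'.add hX').div_const 2) fun x => ?_
    exact (neg_le_abs _).trans (abs_weight_mul_mul_le (hρ0 x) (hρg x))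
  -- (N2) the cut-off commutator term
  have i6 : Integrable fun x => fF x / 4 := iF.div_const 4
  have nX : -(∫ x, fX x) ≤ (∫ x, fF x) / 4 + 16 * C ^ 2 * IX := by
    rw [← integral_neg, ← hIX', ← integral_div, ← integral_const_mul,
      ← integral_add i6 (hX'.const_mul _)]
    refine integral_mono iX.neg (i6.add (hX'.const_mul _)) fun x => ?_
    have hs : |χ₀ x * w₀ x + χ₁ x * w₁ x| ≤ 2 * C * ‖gradient w x‖ := by
      have hb₀ := abs_fderiv_apply_single_le_norm_gradient w x 0
      have hb₁ := abs_fderiv_apply_single_le_norm_gradient w x 1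
      calc |χ₀ x * w₀ x + χ₁ x * w₁ x| ≤ |χ₀ x * w₀ x| + |χ₁ x * w₁ x| := abs_add_le _ _
        _ = |χ₀ x| * |w₀ x| + |χ₁ x| * |w₁ x| := by rw [abs_mul, abs_mul]
        _ ≤ C * ‖gradient w x‖ + C * ‖gradient w x‖ :=
            add_le_add (mul_le_mul (hχ₀C x) hb₀ (abs_nonneg _) hC0)
              (mul_le_mul (hχ₁C x) hb₁ (abs_nonneg _) hC0)
        _ = 2 * C * ‖gradient w x‖ := by ring
    have key := neg_cutoff_commutator_le (w := w x) (hχ0 x) (hgpos x).le hs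
    show -(fX x) ≤ fF x / 4 + 16 * C ^ 2 * (g x * w x ^ 2)
    simp only [hfX, hfF, hρ]
    linarith [key]
  -- (N3) the zeroth-order term
  have nQ : (∫ x, fQ x) ≤ IX := by
    rw [← hIX']
    refine integral_mono iQ hX' fun x => ?_
    show ρ x * (w x * w x) ≤ g x * w x ^ 2
    rw [← pow_two]
    exact mul_le_mul_of_nonneg_right (hρg x) (sq_nonneg _)
  -- (N4) the local rotation term (`v^G` is bounded)
  have nV : -(∫ x, fV x) ≤ (∫ x, fF x) / 4 + (R * (4 * Real.pi)⁻¹) ^ 2 * IX := by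
    rw [← integral_neg, ← hIX', ← integral_div, ← integral_const_mul,
      ← integral_add i6 (hX'.const_mul _)]
    refine integral_mono iV.neg (i6.add (hX'.const_mul _)) fun x => ?_
    have hVb : |V x| ≤ (4 * Real.pi)⁻¹ * ‖gradient w x‖ :=
      (abs_real_inner_le_norm _ _).trans (mul_le_mul_of_nonneg_right
        (norm_gaussVortexVelocity_le_inv_four_pi x) (norm_nonneg _))
    have key := neg_weight_mul_rotation_le (R := R) (w := w x) (hρ0 x) (hρg x) hVb
    show -(fV x) ≤ fF x / 4 + (R * (4 * Real.pi)⁻¹) ^ 2 * (g x * w x ^ 2)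
    simp only [hfV, hfF]
    linarith [key]
  -- (N5) the nonlocal term
  have nP : -(∫ x, fP x) ≤ |R| * IN := by
    rw [← integral_neg, ← hIN', ← integral_const_mul]
    refine integral_mono iP.neg (hN'.const_mul _) fun x => ?_
    show -(ρ x * (R * N x * w x)) ≤ |R| * (g x * (|N x| * |w x|))
    calc -(ρ x * (R * N x * w x)) ≤ |ρ x * (R * N x * w x)| := neg_le_abs _
      _ = ρ x * (|R| * |N x| * |w x|) := by
          rw [abs_mul, abs_of_nonneg (hρ0 x), abs_mul, abs_mul]
      _ ≤ g x * (|R| * |N x| * |w x|) :=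
          mul_le_mul_of_nonneg_right (hρg x) (by positivity)
      _ = |R| * (g x * (|N x| * |w x|)) := by ring
  -- the goal in terms of `∫ ρ ‖∇w‖²`
  have hgoal : ∫ x, χ x ^ 2 * (g x * ‖gradient w x‖ ^ 2) = ∫ x, fF x :=
    integral_congr_ae (Eventually.of_forall fun x => by simp only [hfF, hρ]; ring)
  rw [hgoal]
  linarith [eP, eL', eB, eDs, eD', nJ, nT, nX, nQ, nV, nP]

/-- **Stub 1 of crux stmt-NavierStokesRegularity-17973, line `Sketch` (gradient in the class).**
For `w` in the crux class (`C²`, `w` and `T_{λ,R}w` in `X_λ`, pointwise Biot–Savart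
integrability) the gradient is in `X_λ`: the truncated energy estimate is uniform in the cut-off
scale, and Fatou along `χ_{k+1} → 1` gives `∫ G_λ⁻¹ ‖∇w‖² < ∞`. [folklore] -/
theorem stub_gradientInClass :
    ∀ lam ∈ Set.Ico (0 : ℝ) 1, ∀ (R : ℝ) (w : EuclideanSpace ℝ (Fin 2) → ℝ), ContDiff ℝ 2 w →
    Integrable (fun x => (gaussWeightLam lam x)⁻¹ * w x ^ 2) →
    (∀ x, Integrable (fun y => w y • biotSavartKernel2D (x - y))) →
    Integrable (fun x => (gaussWeightLam lam x)⁻¹ * (strainedVorticityOperator lam w x -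
      R * (⟪gaussVortexVelocity x, gradient w x⟫_ℝ +
        ⟪biotSavart2D w x, gradient gaussVortexProfile x⟫_ℝ)) ^ 2) →
    Integrable (fun x => (gaussWeightLam lam x)⁻¹ * ‖gradient w x‖ ^ 2) := by
  intro lam hlam R w hw hX hK hT
  have hl1 : lam < 1 := hlam.2
  have hN :=
    integrable_inv_gaussWeightLam_mul_abs_inner_biotSavart2D_mul hlam hw.continuous hX hK
  obtain ⟨C, hC0, hC⟩ := exists_cutoff_fderiv_bounds
  have hF : Continuous fun x : EuclideanSpace ℝ (Fin 2) =>
      (gaussWeightLam lam x)⁻¹ * ‖gradient w x‖ ^ 2 :=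
    (contDiff_inv_gaussWeightLam lam (n := 0)).continuous.mul
      ((continuous_gradient_of_contDiff (hw.of_le one_le_two)).norm.pow 2)
  have key := fun k : ℕ =>
    integral_cutoff_sq_mul_inv_gaussWeightLam_mul_norm_gradient_sq_le hlam R hw hX hT hN hC0
      (S := (k : ℝ) + 1) (by simp) (hC _ (by simp))
  exact integrable_of_integral_sq_mul_le (χ := fun k : ℕ => cutoff ((k : ℝ) + 1)) hF
    (fun x => mul_nonneg (inv_pos.2 (gaussWeightLam_pos hl1 x)).le (sq_nonneg _))
    (fun k => (contDiff_cutoff (n := 0) _).continuous)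
    (fun k => hasCompactSupport_cutoff (by positivity)) tendsto_cutoff_natCast_add_one key

end Summit.NavierStokesRegularity.NavierStokesRegularity.Theorems
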